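import Mathlib
import Summits.KontsevichZagierPeriods.KontsevichZagierPeriods.Theorems.InverseLandauTateFamilyKernelIsotopyTwo

/-!
# `TateFamilyKernel` — the JAC (torus pull-back) mechanism in dimension 2 is a relation
# (line `Sketch`, stub `stub_jacClass`)

Crux `TateFamilyKernel` (stmt-KontsevichZagierPeriods-9130, route `InverseLandau`), line `Sketch`:
fibres of identically-vanishing Tate families are KZ relations. This file certifies the JAC
mechanism of the census in dimension `2`.

Data: `Q₁, Q₂ ∈ ℚ[w₀, w₁, ϖ]` with `Q₁ ≡ κ₁` on both faces `w₀ ∈ {0, 1}` and `Q₂ ≡ κ₂` on both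
faces `w₁ ∈ {0, 1}` (stated as divisibilities), a rational `h = B/E ∈ ℚ(y₀, y₁, ϖ)` and a real
algebraic `ϖ₀`. The element `h(Q₁, Q₂, ϖ₀)·Jac(Q₁, Q₂)` is the pull-back of `h dy₀ ∧ dy₁` under
the polynomial self-map `Φ = (Q₁, Q₂)` of the square, which sends the `w₀`-faces into `{y₀ = κ₁}`
and the `w₁`-faces into `{y₁ = κ₂}`. The straight-line family from the constant map,
`Φ_s = ((1 − s)κ₁ + sQ₁, (1 − s)κ₂ + sQ₂)`, is a polynomial isotopy of the kind treated by the
landed transport theorem `stub_isotopyTwo` (rule (2) along a polynomial isotopy is an `m = 1`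
Ayoub certificate): its Jacobian is `s²·Jac(Q₁, Q₂)`, so the `s = 1` end is the given element and
the `s = 0` end vanishes. Hence (`stub_jacClass`) every tame cube representation of
`h(Q₁, Q₂, ϖ₀)·Jac(Q₁, Q₂)` lies in `KZ.relations`, provided `E(Φ_s(w), ϖ₀) ≠ 0` on
`[0,1]² × [0,1]`.

Geometric meaning: with `h = 1/(y₀y₁)` the element is `dlog Q₁ ∧ dlog Q₂ = d(log Q₁ · dlog Q₂)`,
the iterated-residue class of two polar components meeting on the line at infinity — the one
vanishing element of a product of two "fold" factors that is neither Griffiths-exact nor a fold.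

Implementation: the variables of `stub_isotopyTwo` are `X 0 = w₀, X 1 = w₁, X 2 = s, X 3 = ϖ`;
the re-indexing `ι = ![0, 1, 3]` moves `ϖ` from slot `2` of `ℚ[w₀, w₁, ϖ]` to slot `3`, and
`φᵢ = C κᵢ + X 2 * (rename ι Qᵢ − C κᵢ)`. The helper lemmas are stated for a map `ι` together with
the hypothesis `ι = ![0, 1, 3]` (to keep statements short); the proof is formal: `pderiv_rename`,
`aeval_rename`, `aeval_bind₁` and `ring`.
References: Kontsevich–Zagier 2001 §1.2 rules (2), (3); Ayoub, EMS Newsl. 91 (2014) Def. 10.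
-/

noncomputable section

open MeasureTheory Set MvPolynomial
open Literature.NumberTheory.Transcendental

namespace Summit.KontsevichZagierPeriods.InverseLandau.TateFamilyKernel.Descent

namespace JacClass

/-! ### Formal identities for the straight-line family `κ + s·(Q − κ)` -/

/-- The re-indexing `ι = (0 ↦ 0, 1 ↦ 1, 2 ↦ 3)` of `ℚ[w₀, w₁, ϖ]` into `ℚ[w₀, w₁, s, ϖ]` is
injective. [folklore] -/
theorem iota_injective {ι : Fin (2 + 1) → Fin (2 + 1 + 1)} (hι : ι = ![0, 1, 3]) :
    Function.Injective ι := by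
  subst hι
  decide

/-- The re-indexing fixes the cube direction `w₀`: `ι 0 = 0`. [folklore] -/
theorem iota_zero {ι : Fin (2 + 1) → Fin (2 + 1 + 1)} (hι : ι = ![0, 1, 3]) : ι 0 = 0 := by
  subst hι
  rfl

/-- The re-indexing fixes the cube direction `w₁`: `ι 1 = 1`. [folklore] -/
theorem iota_one {ι : Fin (2 + 1) → Fin (2 + 1 + 1)} (hι : ι = ![0, 1, 3]) : ι 1 = 1 := by
  subst hι
  rfl

/-- A face factorisation `Q = κ + L·R` transfers to the straight-line family:
`κ + s(Q − κ) = κ + L·(s·R)` after any re-indexing `ι` (a ring map fixing constants). [folklore] -/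
theorem face_transfer (ι : Fin (2 + 1) → Fin (2 + 1 + 1)) {Q L R : MvPolynomial (Fin (2 + 1)) ℚ}
    {κ : ℚ} (h : Q = C κ + L * R) :
    (C κ + X 2 * (rename ι Q - C κ) : MvPolynomial (Fin (2 + 1 + 1)) ℚ) =
      C κ + rename ι L * (X 2 * rename ι R) := by
  rw [h, map_add, map_mul, rename_C]
  ring

/-- The cube-direction partials of the straight-line family: `∂_{ι j}(κ + s(Q − κ)) = s·∂ⱼQ`
(re-indexed), for a direction `j` of `ℚ[w₀, w₁, ϖ]` not sent to the time slot `2`. [folklore] -/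
theorem pderiv_line {ι : Fin (2 + 1) → Fin (2 + 1 + 1)} (hι : ι = ![0, 1, 3])
    (Q : MvPolynomial (Fin (2 + 1)) ℚ) (κ : ℚ) {j : Fin (2 + 1)}
    (hj : (2 : Fin (2 + 1 + 1)) ≠ ι j) :
    pderiv (ι j) (C κ + X 2 * (rename ι Q - C κ) : MvPolynomial (Fin (2 + 1 + 1)) ℚ) =
      X 2 * rename ι (pderiv j Q) := by
  rw [map_add, pderiv_C, zero_add, pderiv_mul, pderiv_X_of_ne hj, zero_mul, zero_add, map_sub,
    pderiv_C, sub_zero, pderiv_rename (iota_injective hι)]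

/-- **The Jacobian of the straight-line family is `s²·Jac(Q₁, Q₂)`**:
`∂₀φ₁∂₁φ₂ − ∂₁φ₁∂₀φ₂ = s²·(∂₀Q₁∂₁Q₂ − ∂₁Q₁∂₀Q₂)` (re-indexed), `φᵢ = κᵢ + s(Qᵢ − κᵢ)`.
[folklore] -/
theorem jacobian_line {ι : Fin (2 + 1) → Fin (2 + 1 + 1)} (hι : ι = ![0, 1, 3])
    (Q₁ Q₂ : MvPolynomial (Fin (2 + 1)) ℚ) (κ₁ κ₂ : ℚ) :
    pderiv 0 (C κ₁ + X 2 * (rename ι Q₁ - C κ₁) : MvPolynomial (Fin (2 + 1 + 1)) ℚ) *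
          pderiv 1 (C κ₂ + X 2 * (rename ι Q₂ - C κ₂) : MvPolynomial (Fin (2 + 1 + 1)) ℚ) -
        pderiv 1 (C κ₁ + X 2 * (rename ι Q₁ - C κ₁) : MvPolynomial (Fin (2 + 1 + 1)) ℚ) *
          pderiv 0 (C κ₂ + X 2 * (rename ι Q₂ - C κ₂) : MvPolynomial (Fin (2 + 1 + 1)) ℚ) =
      X 2 ^ 2 * rename ι (pderiv 0 Q₁ * pderiv 1 Q₂ - pderiv 1 Q₁ * pderiv 0 Q₂) := by
  subst hι
  have h0 : ∀ (Q : MvPolynomial (Fin (2 + 1)) ℚ) (κ : ℚ),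
      pderiv 0 (C κ + X 2 * (rename ![0, 1, 3] Q - C κ) : MvPolynomial (Fin (2 + 1 + 1)) ℚ) =
        X 2 * rename ![0, 1, 3] (pderiv 0 Q) :=
    fun Q κ => pderiv_line rfl Q κ (j := 0) (by decide)
  have h1 : ∀ (Q : MvPolynomial (Fin (2 + 1)) ℚ) (κ : ℚ),
      pderiv 1 (C κ + X 2 * (rename ![0, 1, 3] Q - C κ) : MvPolynomial (Fin (2 + 1 + 1)) ℚ) =
        X 2 * rename ![0, 1, 3] (pderiv 1 Q) :=
    fun Q κ => pderiv_line rfl Q κ (j := 1) (by decide)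
  rw [h0, h0, h1, h1, map_sub, map_mul, map_mul]
  ring

/-! ### Evaluation at the double slice `(z, c, ϖ₀)` -/

/-- Re-indexed polynomials evaluated at `(z, c, ϖ₀)` are the originals at `(z, ϖ₀)`. [folklore] -/
theorem aeval_rename_iota {ι : Fin (2 + 1) → Fin (2 + 1 + 1)} (hι : ι = ![0, 1, 3])
    (z : Fin 2 → ℝ) (c ϖ₀ : ℝ) (Q : MvPolynomial (Fin (2 + 1)) ℚ) :
    aeval (Fin.snoc (Fin.snoc z c : Fin (2 + 1) → ℝ) ϖ₀ : Fin (2 + 1 + 1) → ℝ) (rename ι Q) =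
      aeval (Fin.snoc z ϖ₀ : Fin (2 + 1) → ℝ) Q := by
  have h : ((Fin.snoc (Fin.snoc z c : Fin (2 + 1) → ℝ) ϖ₀ : Fin (2 + 1 + 1) → ℝ) ∘ ι) =
      (Fin.snoc z ϖ₀ : Fin (2 + 1) → ℝ) := by
    subst hι
    funext j
    fin_cases j <;> rfl
  rw [aeval_rename, h]

/-- The straight-line family evaluated at `(z, c, ϖ₀)` is `(1 − c)κ + c·Q(z, ϖ₀)`. [folklore] -/
theorem aeval_line {ι : Fin (2 + 1) → Fin (2 + 1 + 1)} (hι : ι = ![0, 1, 3]) (z : Fin 2 → ℝ)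
    (c ϖ₀ : ℝ) (Q : MvPolynomial (Fin (2 + 1)) ℚ) (κ : ℚ) :
    aeval (Fin.snoc (Fin.snoc z c : Fin (2 + 1) → ℝ) ϖ₀ : Fin (2 + 1 + 1) → ℝ)
        (C κ + X 2 * (rename ι Q - C κ) : MvPolynomial (Fin (2 + 1 + 1)) ℚ) =
      (1 - c) * κ + c * aeval (Fin.snoc z ϖ₀ : Fin (2 + 1) → ℝ) Q := by
  simp only [map_add, map_mul, map_sub, aeval_C, aeval_X, eq_ratCast, aeval_rename_iota hι,
    Gap.snoc4_2, Gap.snoc3_2]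
  ring

/-- The substitution `y₀ ↦ φ₁, y₁ ↦ φ₂, ϖ ↦ ϖ` followed by evaluation at `(z, c, ϖ₀)` is
evaluation at `Φ_c(z) = ((1 − c)κ₁ + cQ₁(z, ϖ₀), (1 − c)κ₂ + cQ₂(z, ϖ₀))` and `ϖ₀`. [folklore] -/
theorem aeval_bind₁_line {ι : Fin (2 + 1) → Fin (2 + 1 + 1)} (hι : ι = ![0, 1, 3])
    (z : Fin 2 → ℝ) (c ϖ₀ : ℝ) (Q₁ Q₂ P : MvPolynomial (Fin (2 + 1)) ℚ) (κ₁ κ₂ : ℚ) :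
    aeval (Fin.snoc (Fin.snoc z c : Fin (2 + 1) → ℝ) ϖ₀ : Fin (2 + 1 + 1) → ℝ)
        (bind₁ ![C κ₁ + X 2 * (rename ι Q₁ - C κ₁), C κ₂ + X 2 * (rename ι Q₂ - C κ₂), X 3] P) =
      aeval (Fin.snoc (![(1 - c) * κ₁ + c * aeval (Fin.snoc z ϖ₀ : Fin (2 + 1) → ℝ) Q₁,
          (1 - c) * κ₂ + c * aeval (Fin.snoc z ϖ₀ : Fin (2 + 1) → ℝ) Q₂] : Fin 2 → ℝ) ϖ₀ :
        Fin (2 + 1) → ℝ) P := by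
  rw [aeval_bind₁]
  congr 1
  refine congrArg aeval (funext fun j => ?_)
  fin_cases j
  · exact aeval_line hι z c ϖ₀ Q₁ κ₁
  · exact aeval_line hι z c ϖ₀ Q₂ κ₂
  · exact (aeval_X _ _).trans rfl

/-- At the end `c = 1` of the isotopy the substituted-and-evaluated `P` is `P(Q₁, Q₂, ϖ₀)`.
[folklore] -/
theorem aeval_bind₁_line_one {ι : Fin (2 + 1) → Fin (2 + 1 + 1)} (hι : ι = ![0, 1, 3])
    (z : Fin 2 → ℝ) (ϖ₀ : ℝ) (Q₁ Q₂ P : MvPolynomial (Fin (2 + 1)) ℚ) (κ₁ κ₂ : ℚ) :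
    aeval (Fin.snoc (Fin.snoc z 1 : Fin (2 + 1) → ℝ) ϖ₀ : Fin (2 + 1 + 1) → ℝ)
        (bind₁ ![C κ₁ + X 2 * (rename ι Q₁ - C κ₁), C κ₂ + X 2 * (rename ι Q₂ - C κ₂), X 3] P) =
      aeval (Fin.snoc (![aeval (Fin.snoc z ϖ₀ : Fin (2 + 1) → ℝ) Q₁,
          aeval (Fin.snoc z ϖ₀ : Fin (2 + 1) → ℝ) Q₂] : Fin 2 → ℝ) ϖ₀ : Fin (2 + 1) → ℝ) P := by
  rw [aeval_bind₁_line hι]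
  simp only [sub_self, zero_mul, one_mul, zero_add]

end JacClass

open JacClass in
/-- STUB `stub_jacClass` of line `Sketch` — **the JAC (torus pull-back) mechanism in dimension 2 is
a relation.** Data: `Q₁, Q₂ ∈ ℚ[w₀, w₁, ϖ]` with `Q₁ ≡ κ₁` on both faces `w₀ ∈ {0,1}` and `Q₂ ≡ κ₂`
on both faces `w₁ ∈ {0,1}` (divisibilities `h10 … h21`), `h = B/E ∈ ℚ(y₀, y₁, ϖ)`, `ϖ₀` real
algebraic with `E(Φ_s(w), ϖ₀) ≠ 0` on `[0,1]² × [0,1]` along the straight-line family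
`Φ_s = ((1−s)κ₁ + sQ₁, (1−s)κ₂ + sQ₂)`. Conclusion: every tame cube representation of
`h(Q₁, Q₂, ϖ₀)·Jac(Q₁, Q₂)` — the pull-back `Φ^*(h dy₀ ∧ dy₁)` under `Φ = (Q₁, Q₂)`, a polynomial
self-map of the square sending the `w₀`-faces into `{y₀ = κ₁}` and the `w₁`-faces into `{y₁ = κ₂}` —
lies in `KZ.relations`. With `h = 1/(y₀y₁)` this is `dlog Q₁ ∧ dlog Q₂ = d(log Q₁ · dlog Q₂)`, the
iterated-residue class of two polar components meeting on the line at infinity (the one vanishing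
element of a product of two fold factors that is neither Griffiths-exact nor a fold).
Proof: `stub_isotopyTwo` for `φᵢ = κᵢ + s·(Qᵢ − κᵢ)` (re-indexed by `ι = ![0, 1, 3]`),
`c₁₀ = c₁₁ = κ₁`, `c₂₀ = c₂₁ = κ₂`: the face factorisations transfer (`face_transfer`), `E∘Φ_s ≠ 0`
on `[0,1]³` is `hE` at `s = w₂` (`aeval_bind₁_line`), and the Jacobian of the family is
`s²·Jac(Q₁, Q₂)` (`jacobian_line`), so its `s = 1` end is the given integrand and its `s = 0` end
vanishes. [cite: KontsevichZagier2001, §1.2 rules (2), (3)] [cite: Ayoub2014, Def. 10] -/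
theorem stub_jacClass (Q₁ Q₂ B E : MvPolynomial (Fin (2 + 1)) ℚ) (κ₁ κ₂ : ℚ)
    (h10 : ∃ R : MvPolynomial (Fin (2 + 1)) ℚ, Q₁ = C κ₁ + X 0 * R)
    (h11 : ∃ R : MvPolynomial (Fin (2 + 1)) ℚ, Q₁ = C κ₁ + (1 - X 0) * R)
    (h20 : ∃ R : MvPolynomial (Fin (2 + 1)) ℚ, Q₂ = C κ₂ + X 1 * R)
    (h21 : ∃ R : MvPolynomial (Fin (2 + 1)) ℚ, Q₂ = C κ₂ + (1 - X 1) * R)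
    (ϖ₀ : ℝ) (halg : IsAlgebraic ℚ ϖ₀)
    (hE : ∀ w ∈ KZ.cube 2, ∀ s ∈ Icc (0 : ℝ) 1,
      aeval (Fin.snoc (![(1 - s) * κ₁ + s * aeval (Fin.snoc w ϖ₀ : Fin (2 + 1) → ℝ) Q₁,
          (1 - s) * κ₂ + s * aeval (Fin.snoc w ϖ₀ : Fin (2 + 1) → ℝ) Q₂] : Fin 2 → ℝ) ϖ₀ :
        Fin (2 + 1) → ℝ) E ≠ 0) :
    ∀ R : KZ.IntegralRep 2, R.IsTameCube →
      (∀ w ∈ KZ.cube 2, R.integrand w =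
        aeval (Fin.snoc (![aeval (Fin.snoc w ϖ₀ : Fin (2 + 1) → ℝ) Q₁,
            aeval (Fin.snoc w ϖ₀ : Fin (2 + 1) → ℝ) Q₂] : Fin 2 → ℝ) ϖ₀ : Fin (2 + 1) → ℝ) B /
          aeval (Fin.snoc (![aeval (Fin.snoc w ϖ₀ : Fin (2 + 1) → ℝ) Q₁,
            aeval (Fin.snoc w ϖ₀ : Fin (2 + 1) → ℝ) Q₂] : Fin 2 → ℝ) ϖ₀ : Fin (2 + 1) → ℝ) E *
          aeval (Fin.snoc w ϖ₀ : Fin (2 + 1) → ℝ)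
            (pderiv 0 Q₁ * pderiv 1 Q₂ - pderiv 1 Q₁ * pderiv 0 Q₂)) →
      KZ.of R ∈ KZ.relations := by
  intro R hR hRi
  -- the re-indexing `ι : ℚ[w₀, w₁, ϖ] → ℚ[w₀, w₁, s, ϖ]`, kept opaque behind `hι`
  obtain ⟨ι, hι⟩ : ∃ ι : Fin (2 + 1) → Fin (2 + 1 + 1), ι = ![0, 1, 3] := ⟨_, rfl⟩
  obtain ⟨R₁, hR₁⟩ := h10
  obtain ⟨R₁', hR₁'⟩ := h11
  obtain ⟨R₂, hR₂⟩ := h20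
  obtain ⟨R₂', hR₂'⟩ := h21
  refine stub_isotopyTwo (C κ₁ + X 2 * (rename ι Q₁ - C κ₁)) (C κ₂ + X 2 * (rename ι Q₂ - C κ₂))
    B E κ₁ κ₁ κ₂ κ₂
    ⟨X 2 * rename ι R₁, by rw [face_transfer ι hR₁, rename_X, iota_zero hι]⟩
    ⟨X 2 * rename ι R₁', by rw [face_transfer ι hR₁', map_sub, map_one, rename_X, iota_zero hι]⟩
    ⟨X 2 * rename ι R₂, by rw [face_transfer ι hR₂, rename_X, iota_one hι]⟩
    ⟨X 2 * rename ι R₂', by rw [face_transfer ι hR₂', map_sub, map_one, rename_X, iota_one hι]⟩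
    ϖ₀ halg (fun w hw => ?_) R hR (fun z hz => ?_)
  · -- `E ∘ Φ_s ≠ 0` on the closed cube `[0,1]³`: the hypothesis `hE` at `s = w₂`
    obtain ⟨z, c, rfl⟩ : ∃ (z : Fin 2 → ℝ) (c : ℝ), (Fin.snoc z c : Fin (2 + 1) → ℝ) = w :=
      ⟨Fin.init w, w (Fin.last 2), Fin.snoc_init_self w⟩
    obtain ⟨hz, hc0, hc1⟩ := KZ.snoc_mem_cube_iff.1 hw
    rw [aeval_bind₁_line hι]
    exact hE z hz c ⟨hc0, hc1⟩
  · -- the integrand is the `s = 1` end of `h(Φ_s)·J_s`; the `s = 0` end vanishes (`J_s = s²·Jac`)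
    rw [hRi z hz, jacobian_line hι]
    simp only [map_mul, map_pow, aeval_X, aeval_rename_iota hι, aeval_bind₁_line_one hι,
      Gap.snoc4_2, Gap.snoc3_2]
    ring

end Summit.KontsevichZagierPeriods.InverseLandau.TateFamilyKernel.Descent
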